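import Literature.MathematicalPhysics.QuantumFieldTheory.Balaban1983to89.BlockAveragingFederbushGValued

/-!
# PRINT'S PRODUCT DESCRIPTION `𝐔 = U′U` OF THE COMPLEXIFIED GROUP, FOR THE TREE'S LOG-CHARTED `Gᶜ`:
# THE LOCAL POLAR FORM `𝐔 = e^{log(𝐔𝐔*)/2} · U`

T. Bałaban, *Renormalization group approach to lattice gauge field theories. I*, Comm. Math. Phys. **109** (1987)
249–301 (`Balaban1987RG1`, "B12"), p. 252 (quoted VERBATIM in the header of `BlockAveragingFederbushGValued`,
read there on the render; `GAPS.md` C-pv26g9-1):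

«Therefore we also consider the complexified group Gᶜ. Elements of this group are defined as matrices of the form
𝐔 = U′U, where U ∈ G and U′ = exp iA′, A′ ∈ 𝐠ᶜ, 𝐠ᶜ is the complexification of the real Lie algebra 𝐠.»

## What this file PROVES (nothing printed is asserted; every statement is about the tree's constructions)

`BlockAveragingFederbushGValued` (§2, §6) models print's `Gᶜ` for `G = SU(N)`, `O(N)`, `SO(N)` by EQUATIONS —
`specialLinearLogChart = {det g = 1}`, `complexOrthogonalLogChart = {gᵀ g = 1}`,
`specialComplexOrthogonalLogChart = {gᵀ g = 1, det g = 1}` — and not by print's PRODUCTS `U′U` (recorded as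
`DIVERGENCE.md` D-pv26g9.2).  This file proves that NEAR THE IDENTITY the two descriptions agree, for ANY log-charted
`Gc : LogChart (Matrix n n ℂ)` whose carrier is closed under `star`:

* PRODUCTS ⊆ EQUATIONS (global, one line): `Q ∈ 𝔤c`, `U ∈ Gc` ⟹ `e^{Q} U ∈ Gc` (`LogChart.exp_mul_mem`).
* EQUATIONS ⊆ PRODUCTS (local) — THE POLAR FORM.  For `𝐔 ∈ Gc` with `‖𝐔 − 1‖ ≤ ε`, `ε ≤ 1/10`, `3ε ≤ ρ`:
  `P := log(𝐔𝐔*)` (`polarLog`, the series (21)) satisfies `‖𝐔𝐔* − 1‖ ≤ (21/10)ε` (`norm_self_mul_star_sub_one_le`),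
  `P* = P` (`star_polarLog`, by the tree's `FederbushMean.mlog_star`), `e^{P} = 𝐔𝐔*` (`exp_polarLog`), `‖P‖ ≤ 3ε`
  (`norm_polarLog_le`) and `P ∈ 𝔤c` (`LogChart.polarLog_mem_lie`, by `mlog_mem`); `U′ := e^{P/2}` (`polarPos`) lies in
  `Gc` and is self-adjoint; `U := e^{−P/2} 𝐔` (`polarUnit`) lies in `Gc` AND IS UNITARY (`U U* = e^{−P/2} e^{P} e^{−P/2}
  = 1`, `polarUnit_mem_unitaryGroup`); and `𝐔 = U′ U` (`polarPos_mul_polarUnit`).  With `A′ := −(i/2) P` (`polarGen`):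
  `U′ = exp(iA′)` (`polarPos_eq_exp_I_smul_polarGen`) and `iA′ = P/2 ∈ 𝔤c`; packaged as `LogChart.exists_polar`.
* INSTANCES: `Gc = SL(N, ℂ)` ⟹ `U ∈ SU(N)`, `A′ ∈ ker tr`; `Gc = O(N, ℂ)` ⟹ `U ∈ O(N)` (a unitary complex-orthogonal
  matrix is real: `Uᵀ = U⁻¹ = U*`, `mem_orthogonalLogChart_of_mem_unitaryGroup`), `A′` antisymmetric;
  `Gc = SO(N, ℂ)` ⟹ `U ∈ SO(N)`.  So for these three groups every `𝐔 ∈ Gc` near `1` has print's form `U′U` with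
  `U ∈ G = Gc ∩ U(N)` and `U′ = exp iA′`, `A′ ∈ 𝔤ᶜ`.
* §4 (v1.1) THE CARTAN FORM, BOUNDS, UNIQUENESS.  `A′* = −A′` (`star_polarGen`), so `A′ ∈ 𝔲(N)`
  (`polarGen_mem_unitaryLogChart_lie`); if `𝔤c` is closed under multiplication by `i` (print's `𝐠ᶜ` is a complex
  Lie algebra) then `A′ ∈ 𝔤c` (`LogChart.polarGen_mem_lie`), i.e. `A′` lies in the REAL form `𝔤c ∩ 𝔲(N)` and
  `𝐔 = exp(iA′) U` with `A′ ∈ 𝔤c ∩ 𝔲(N)`, `U ∈ Gc ∩ U(N)` (`LogChart.exists_cartan`); instances `A′ ∈ 𝔰𝔲(N)`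
  (`polarGen_mem_specialUnitaryLogChart_lie`), `A′ ∈ 𝔬(N)` = real antisymmetric (`polarGen_mem_orthogonalLogChart_lie`;
  a self-adjoint antisymmetric matrix is purely imaginary), `A′ ∈ 𝔰𝔬(N)` (`polarGen_mem_specialOrthogonalLogChart_lie`).
  BOUNDS `‖U′ − 1‖ ≤ (7/4)ε` (`norm_polarPos_sub_one_le`), `‖U − 1‖ ≤ 3ε` (`norm_polarUnit_sub_one_le`).  UNIQUENESS
  in the small class: if `𝐔 = e^{P′/2} U′` with `P′* = P′`, `‖P′‖ < ln 2`, `U′` unitary, then `P′ = P`, `U′ = U`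
  (`polar_unique`, by the tree's `B7BlockAvgLog.mlog_exp`); equivalently `𝐔 = exp(iA) U`, `A* = −A`, `‖A‖ < (ln 2)/2`,
  `U` unitary ⟹ `A = A′`, `U = U(𝐔)` (`cartan_unique`).  POSITIVITY (v1.2, §4d): `U′ = (e^{P/4})ᴴ e^{P/4}` is
  POSITIVE DEFINITE (`posDef_polarPos`, Mathlib `Matrix.PosDef.conjTranspose_mul_self`; eigenvalues `> 0`,
  `polarPos_eigenvalues_pos`), and so is `𝐔𝐔*` (`posDef_self_mul_star`); `e^{X}` is a unit (`isUnit_exp_matrix`).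

## What is NOT encoded

* Anything global: `Gc = exp(i𝔤)·G` on all of `Gc`, uniqueness outside the small class of §4c (`‖P′‖ < ln 2`,
  `‖A‖ < (ln 2)/2`); only the local product form at radius `ε ≤ min(1/10, ρ/3)` (print uses `𝐔_j` «with
  sufficiently small diameters» only).  The radii and the constants `7/4`, `3` of §4b are the FILE's.
* That print's `G` is `Gc ∩ U(N)`: for the three instances this is the kernel lemmas below; for a general chart it is
  the file's READING of «U ∈ G».  Cartan's theorem (every closed subgroup is log-charted) is not available
  (`BlockAveragingFederbushGValued`, «NOT encoded»).

Model conventions: everything here is `[folklore]` (polar decomposition in a Banach `*`-algebra near the identity);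
the quotation above is context, not a claim.

v1.1 (this lineage): §4 appended (Cartan form `A′ ∈ 𝔤c ∩ 𝔲(N)` and its instances, the bounds `‖U′ − 1‖ ≤ (7/4)ε`,
`‖U − 1‖ ≤ 3ε`, uniqueness of the factors in the small class) and this header's §4 bullet; §1–§3 are byte-identical
to v1 (p185782).  v1.2: §4d appended (positive definiteness of `U′` and of `𝐔𝐔*`; `open scoped ComplexOrder` for
Mathlib's order on `ℂ`), the former «positivity not encoded» clause removed; §1–§4c byte-identical to v1.1 (p186356).
-/

noncomputable section

open NormedSpace Metric Set Filter Topology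

namespace Literature.MathematicalPhysics.QuantumFieldTheory.Balaban1983to89

open MatrixLog
open scoped Matrix.Norms.L2Operator ComplexOrder

variable {n : Type*} [Fintype n] [DecidableEq n]

/-! ## §1 The polar data of a matrix near the identity -/

/-- `P = log(g g*)` (the series (21) at `g g*`). [folklore] -/
def polarLog (g : Matrix n n ℂ) : Matrix n n ℂ := mlog (g * star g)

/-- `U′ = e^{P/2}`, `P = log(g g*)` — the self-adjoint polar factor. [folklore] -/
def polarPos (g : Matrix n n ℂ) : Matrix n n ℂ := exp ((1 / 2 : ℝ) • polarLog g)

/-- `U = e^{−P/2} g`, `P = log(g g*)` — the unitary polar factor. [folklore] -/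
def polarUnit (g : Matrix n n ℂ) : Matrix n n ℂ := exp (-((1 / 2 : ℝ) • polarLog g)) * g

/-- `A′ = −(i/2) P`, so that `U′ = exp(iA′)` in print's notation. [folklore] -/
def polarGen (g : Matrix n n ℂ) : Matrix n n ℂ := (-(Complex.I / 2)) • polarLog g

/-- `‖g g* − 1‖ ≤ (21/10) ε` for `‖g − 1‖ ≤ ε ≤ 1/10` (`g g* − 1 = (g − 1)(g* − 1) + (g − 1) + (g* − 1)`,
`‖g* − 1‖ = ‖g − 1‖`). [folklore] -/
theorem norm_self_mul_star_sub_one_le {g : Matrix n n ℂ} {ε : ℝ} (hg : ‖g - 1‖ ≤ ε) (hε : ε ≤ 1 / 10) :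
    ‖g * star g - 1‖ ≤ 21 / 10 * ε := by
  have hε0 : 0 ≤ ε := (norm_nonneg _).trans hg
  have hs : ‖star g - 1‖ ≤ ε := by
    rw [← norm_star, star_sub, star_star, star_one]; exact hg
  have h : g * star g - 1 = (g - 1) * (star g - 1) + (g - 1) + (star g - 1) := by noncomm_ring
  rw [h]
  calc ‖(g - 1) * (star g - 1) + (g - 1) + (star g - 1)‖
      ≤ ‖(g - 1) * (star g - 1)‖ + ‖g - 1‖ + ‖star g - 1‖ := norm_add₃_le
    _ ≤ ‖g - 1‖ * ‖star g - 1‖ + ‖g - 1‖ + ‖star g - 1‖ := by gcongr; exact norm_mul_le _ _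
    _ ≤ ε * ε + ε + ε := by gcongr
    _ ≤ 21 / 10 * ε := by nlinarith

/-- `‖g g* − 1‖ ≤ 1/3` (so the tree's `log`-lemmas at radius `1/3` apply to `g g*`). [folklore] -/
theorem norm_self_mul_star_sub_one_le_third {g : Matrix n n ℂ} (hg : ‖g - 1‖ ≤ 1 / 10) :
    ‖g * star g - 1‖ ≤ 1 / 3 :=
  (norm_self_mul_star_sub_one_le hg le_rfl).trans (by norm_num)

/-- `P* = P`: `log(g g*)` is self-adjoint (`(g g*)* = g g*` and the tree's `FederbushMean.mlog_star`). [folklore] -/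
theorem star_polarLog {g : Matrix n n ℂ} (hg : ‖g - 1‖ ≤ 1 / 10) : star (polarLog g) = polarLog g := by
  unfold polarLog
  rw [← FederbushMean.mlog_star (norm_self_mul_star_sub_one_le_third hg), star_mul, star_star]

/-- `e^{P} = g g*`. [folklore] -/
theorem exp_polarLog {g : Matrix n n ℂ} (hg : ‖g - 1‖ ≤ 1 / 10) : exp (polarLog g) = g * star g :=
  exp_mlog ((norm_self_mul_star_sub_one_le_third hg).trans_lt (by norm_num))

/-- `‖P‖ ≤ 3ε` for `‖g − 1‖ ≤ ε ≤ 1/10` ((26): `‖log X‖ ≤ ‖X − 1‖/(1 − ‖X − 1‖)` with `‖X − 1‖ ≤ (21/10)ε ≤ 21/100`).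
[folklore] -/
theorem norm_polarLog_le {g : Matrix n n ℂ} {ε : ℝ} (hg : ‖g - 1‖ ≤ ε) (hε : ε ≤ 1 / 10) :
    ‖polarLog g‖ ≤ 3 * ε := by
  have hε0 : 0 ≤ ε := (norm_nonneg _).trans hg
  have hx := norm_self_mul_star_sub_one_le hg hε
  have hx1 : ‖g * star g - 1‖ < 1 := by nlinarith
  refine (norm_mlog_le_div hx1).trans ?_
  rw [div_le_iff₀ (by linarith)]
  nlinarith [norm_nonneg (g * star g - 1)]

/-- `U′ U = g` (`e^{P/2} e^{−P/2} = 1`). [folklore] -/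
theorem polarPos_mul_polarUnit (g : Matrix n n ℂ) : polarPos g * polarUnit g = g := by
  letI : NormedAlgebra ℚ (Matrix n n ℂ) := NormedAlgebra.restrictScalars ℚ ℂ _
  unfold polarPos polarUnit
  rw [← Matrix.mul_assoc, ← exp_add_of_commute (Commute.refl _).neg_right, add_neg_cancel, exp_zero,
    Matrix.one_mul]

/-- `U′* = U′`. [folklore] -/
theorem star_polarPos {g : Matrix n n ℂ} (hg : ‖g - 1‖ ≤ 1 / 10) : star (polarPos g) = polarPos g := by
  letI : NormedAlgebra ℚ (Matrix n n ℂ) := NormedAlgebra.restrictScalars ℚ ℂ _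
  unfold polarPos
  rw [star_exp, star_smul, star_trivial, star_polarLog hg]

omit [Fintype n] [DecidableEq n] in
/-- `−P/2 + P + (−P/2) = 0`. [folklore] -/
theorem neg_half_add_add_neg_half (P : Matrix n n ℂ) :
    -((1 / 2 : ℝ) • P) + P + -((1 / 2 : ℝ) • P) = 0 := by
  have h : (1 / 2 : ℝ) • P + (1 / 2 : ℝ) • P = P := by
    rw [← add_smul]; norm_num
  calc -((1 / 2 : ℝ) • P) + P + -((1 / 2 : ℝ) • P) = P - ((1 / 2 : ℝ) • P + (1 / 2 : ℝ) • P) := by abel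
    _ = 0 := by rw [h, sub_self]

/-- **`U U* = 1`**: `e^{−P/2} (g g*) e^{−P/2} = e^{−P/2} e^{P} e^{−P/2} = e^{0}`. [folklore] -/
theorem polarUnit_mul_star {g : Matrix n n ℂ} (hg : ‖g - 1‖ ≤ 1 / 10) : polarUnit g * star (polarUnit g) = 1 := by
  letI : NormedAlgebra ℚ (Matrix n n ℂ) := NormedAlgebra.restrictScalars ℚ ℂ _
  set P := polarLog g with hPdef
  set Q : Matrix n n ℂ := -((1 / 2 : ℝ) • P) with hQdef
  have hsQ : star Q = Q := by
    rw [hQdef, star_neg, star_smul, star_trivial, star_polarLog hg]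
  have hQP : Commute Q P := ((Commute.refl P).smul_left (1 / 2 : ℝ)).neg_left
  have hQPQ : Commute (Q + P) Q := (Commute.refl Q).add_left hQP.symm
  have hstarU : star (polarUnit g) = star g * exp Q := by
    show star (exp Q * g) = star g * exp Q
    rw [star_mul, star_exp, hsQ]
  have hsum : Q + P + Q = 0 := by rw [hQdef]; exact neg_half_add_add_neg_half P
  calc polarUnit g * star (polarUnit g) = exp Q * (g * star g) * exp Q := by
        rw [hstarU]; show exp Q * g * (star g * exp Q) = _; noncomm_ring
    _ = exp Q * exp P * exp Q := by rw [exp_polarLog hg]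
    _ = exp (Q + P + Q) := by rw [← exp_add_of_commute hQP, ← exp_add_of_commute hQPQ]
    _ = 1 := by rw [hsum, exp_zero]

/-- **THE UNITARY POLAR FACTOR IS UNITARY.** [folklore] -/
theorem polarUnit_mem_unitaryGroup {g : Matrix n n ℂ} (hg : ‖g - 1‖ ≤ 1 / 10) :
    polarUnit g ∈ Matrix.unitaryGroup n ℂ :=
  Matrix.mem_unitaryGroup_iff.2 (polarUnit_mul_star hg)

/-- `U′ = exp(iA′)` with `A′ = −(i/2)P`. [folklore] -/
theorem polarPos_eq_exp_I_smul_polarGen (g : Matrix n n ℂ) : polarPos g = exp (Complex.I • polarGen g) := by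
  unfold polarPos polarGen
  congr 1
  rw [smul_smul, ← Complex.coe_smul]
  congr 1
  rw [mul_neg, mul_div_assoc', Complex.I_mul_I]
  push_cast
  norm_num

/-- `iA′ = P/2`. [folklore] -/
theorem I_smul_polarGen (g : Matrix n n ℂ) : Complex.I • polarGen g = (1 / 2 : ℝ) • polarLog g := by
  unfold polarGen
  rw [smul_smul, ← Complex.coe_smul]
  congr 1
  rw [mul_neg, mul_div_assoc', Complex.I_mul_I]
  push_cast
  norm_num

/-! ## §2 The polar form inside a `star`-closed log-charted `Gc` -/

namespace LogChart

variable (Gc : LogChart (Matrix n n ℂ))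

/-- PRODUCTS ⊆ EQUATIONS: `e^{Q} U ∈ Gc` for `Q ∈ 𝔤c`, `U ∈ Gc` (print's `U′U` with `U′ = exp iA′`, `iA′ = Q`).
[folklore] -/
theorem exp_mul_mem {Q U : Matrix n n ℂ} (hQ : Q ∈ Gc.lie) (hU : U ∈ Gc.carrier) : exp Q * U ∈ Gc.carrier :=
  Gc.mul_mem (Gc.exp_mem hQ) hU

variable {Gc}

/-- `P = log(𝐔𝐔*) ∈ 𝔤c` for `𝐔 ∈ Gc` (`star`-closed), `‖𝐔 − 1‖ ≤ ε ≤ 1/10`, `3ε ≤ ρ`. [folklore] -/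
theorem polarLog_mem_lie (hstar : ∀ ⦃g⦄, g ∈ Gc.carrier → star g ∈ Gc.carrier) {g : Matrix n n ℂ} {ε : ℝ}
    (hgG : g ∈ Gc.carrier) (hg : ‖g - 1‖ ≤ ε) (hε : ε ≤ 1 / 10) (hρ : 3 * ε ≤ Gc.ρ) : polarLog g ∈ Gc.lie :=
  Gc.mlog_mem (Gc.mul_mem hgG (hstar hgG))
    ((norm_self_mul_star_sub_one_le hg hε).trans (by linarith [(norm_nonneg _).trans hg]))

/-- `U′ = e^{P/2} ∈ Gc`. [folklore] -/
theorem polarPos_mem (hstar : ∀ ⦃g⦄, g ∈ Gc.carrier → star g ∈ Gc.carrier) {g : Matrix n n ℂ} {ε : ℝ}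
    (hgG : g ∈ Gc.carrier) (hg : ‖g - 1‖ ≤ ε) (hε : ε ≤ 1 / 10) (hρ : 3 * ε ≤ Gc.ρ) :
    polarPos g ∈ Gc.carrier :=
  Gc.exp_mem (Gc.lie.smul_mem _ (polarLog_mem_lie hstar hgG hg hε hρ))

/-- `U = e^{−P/2} 𝐔 ∈ Gc`. [folklore] -/
theorem polarUnit_mem (hstar : ∀ ⦃g⦄, g ∈ Gc.carrier → star g ∈ Gc.carrier) {g : Matrix n n ℂ} {ε : ℝ}
    (hgG : g ∈ Gc.carrier) (hg : ‖g - 1‖ ≤ ε) (hε : ε ≤ 1 / 10) (hρ : 3 * ε ≤ Gc.ρ) :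
    polarUnit g ∈ Gc.carrier :=
  Gc.mul_mem (Gc.exp_mem (Gc.lie.neg_mem (Gc.lie.smul_mem _ (polarLog_mem_lie hstar hgG hg hε hρ)))) hgG

/-- `iA′ = P/2 ∈ 𝔤c`. [folklore] -/
theorem I_smul_polarGen_mem_lie (hstar : ∀ ⦃g⦄, g ∈ Gc.carrier → star g ∈ Gc.carrier) {g : Matrix n n ℂ}
    {ε : ℝ} (hgG : g ∈ Gc.carrier) (hg : ‖g - 1‖ ≤ ε) (hε : ε ≤ 1 / 10) (hρ : 3 * ε ≤ Gc.ρ) :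
    Complex.I • polarGen g ∈ Gc.lie := by
  rw [I_smul_polarGen]; exact Gc.lie.smul_mem _ (polarLog_mem_lie hstar hgG hg hε hρ)

/-- **THE LOCAL POLAR FORM OF A `star`-CLOSED LOG-CHARTED `Gc` (print's «𝐔 = U′U, U ∈ G, U′ = exp iA′,
A′ ∈ 𝐠ᶜ» for the tree's equation-defined `Gᶜ`, near the identity).**  For `𝐔 ∈ Gc`, `‖𝐔 − 1‖ ≤ ε ≤ 1/10`,
`3ε ≤ ρ`: there are `P ∈ 𝔤c` with `P* = P`, `e^{P} = 𝐔𝐔*`, and `U ∈ Gc ∩ U(N)` with `𝐔 = e^{P/2} U`. [folklore] -/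
theorem exists_polar (hstar : ∀ ⦃g⦄, g ∈ Gc.carrier → star g ∈ Gc.carrier) {g : Matrix n n ℂ} {ε : ℝ}
    (hgG : g ∈ Gc.carrier) (hg : ‖g - 1‖ ≤ ε) (hε : ε ≤ 1 / 10) (hρ : 3 * ε ≤ Gc.ρ) :
    ∃ P U : Matrix n n ℂ, P ∈ Gc.lie ∧ star P = P ∧ exp P = g * star g ∧ U ∈ Gc.carrier ∧
      U ∈ Matrix.unitaryGroup n ℂ ∧ g = exp ((1 / 2 : ℝ) • P) * U := by
  have hg' : ‖g - 1‖ ≤ 1 / 10 := hg.trans hε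
  exact ⟨polarLog g, polarUnit g, polarLog_mem_lie hstar hgG hg hε hρ, star_polarLog hg', exp_polarLog hg',
    polarUnit_mem hstar hgG hg hε hρ, polarUnit_mem_unitaryGroup hg', (polarPos_mul_polarUnit g).symm⟩

end LogChart

/-! ## §3 Instances: `SL(N, ℂ) → SU(N)`, `O(N, ℂ) → O(N)`, `SO(N, ℂ) → SO(N)` -/

/-- A UNITARY COMPLEX-ORTHOGONAL MATRIX IS REAL ORTHOGONAL: `Uᵀ U = 1 = U* U` ⟹ `Uᵀ = U*` ⟹ `Ū = U`. [folklore] -/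
theorem mem_orthogonalLogChart_of_mem_unitaryGroup {U : Matrix n n ℂ} (hu : U ∈ Matrix.unitaryGroup n ℂ)
    (ho : U.transpose * U = 1) : U ∈ (orthogonalLogChart n).carrier := by
  refine (mem_orthogonalLogChart_carrier).2 ⟨hu, ?_⟩
  have h1 : U⁻¹ = U.transpose := Matrix.inv_eq_left_inv ho
  have h2 : U⁻¹ = star U := Matrix.inv_eq_left_inv (Matrix.mem_unitaryGroup_iff'.1 hu)
  have h3 : (star U).transpose = U := by rw [← h2, h1, Matrix.transpose_transpose]
  have e1 : (star U).transpose = conjEntry n U := by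
    ext i j; simp [conjEntry_apply, Matrix.map_apply, Matrix.star_apply, Matrix.transpose_apply]
  rw [← e1, h3]

/-- **`Gc = SL(N, ℂ)`: the unitary polar factor of `𝐔 ∈ SL(N, ℂ)`, `‖𝐔 − 1‖ ≤ ε ≤ 1/10`, `3ε ≤ min(1/3, 3/N)`,
lies in `SU(N)`**, and `U′ = e^{P/2} ∈ SL(N, ℂ)`, `iA′ ∈ ker tr`. [folklore] -/
theorem polarUnit_mem_specialUnitaryGroup [Nonempty n] {g : Matrix n n ℂ} {ε : ℝ} (hdet : g.det = 1)
    (hg : ‖g - 1‖ ≤ ε) (hε : ε ≤ 1 / 10) (hρ : 3 * ε ≤ min (1 / 3) (3 / (Fintype.card n : ℝ))) :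
    polarUnit g ∈ Matrix.specialUnitaryGroup n ℂ ∧ (polarPos g).det = 1 ∧ (Complex.I • polarGen g).trace = 0 := by
  have hstar : ∀ ⦃g : Matrix n n ℂ⦄, g ∈ (specialLinearLogChart n).carrier →
      star g ∈ (specialLinearLogChart n).carrier := fun _ hg => FederbushMean.star_mem_specialLinearLogChart hg
  have hgG : g ∈ (specialLinearLogChart n).carrier := (mem_specialLinearLogChart_carrier).2 hdet
  have hρ' : 3 * ε ≤ (specialLinearLogChart n).ρ := by rwa [specialLinearLogChart_ρ]
  refine ⟨Matrix.mem_specialUnitaryGroup_iff.2 ⟨polarUnit_mem_unitaryGroup (hg.trans hε), ?_⟩, ?_, ?_⟩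
  · exact (mem_specialLinearLogChart_carrier).1 (LogChart.polarUnit_mem hstar hgG hg hε hρ')
  · exact (mem_specialLinearLogChart_carrier).1 (LogChart.polarPos_mem hstar hgG hg hε hρ')
  · exact (mem_specialLinearLogChart_lie).1 (LogChart.I_smul_polarGen_mem_lie hstar hgG hg hε hρ')

/-- **`Gc = O(N, ℂ)`: the unitary polar factor of `𝐔` with `𝐔ᵀ𝐔 = 1`, `‖𝐔 − 1‖ ≤ 1/10`, lies in `O(N)`**, and
`U′ ∈ O(N, ℂ)`, `(iA′)ᵀ = −iA′`. [folklore] -/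
theorem polarUnit_mem_orthogonal {g : Matrix n n ℂ} (ho : g.transpose * g = 1) (hg : ‖g - 1‖ ≤ 1 / 10) :
    polarUnit g ∈ (orthogonalLogChart n).carrier ∧ (polarPos g).transpose * polarPos g = 1 ∧
      (Complex.I • polarGen g).transpose = -(Complex.I • polarGen g) := by
  have hstar : ∀ ⦃g : Matrix n n ℂ⦄, g ∈ (complexOrthogonalLogChart n).carrier →
      star g ∈ (complexOrthogonalLogChart n).carrier :=
    fun _ hg => FederbushMean.star_mem_complexOrthogonalLogChart hg
  have hgG : g ∈ (complexOrthogonalLogChart n).carrier := (mem_complexOrthogonalLogChart_carrier).2 ho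
  have hρ' : 3 * (1 / 10 : ℝ) ≤ (complexOrthogonalLogChart n).ρ := by rw [complexOrthogonalLogChart_ρ]; norm_num
  refine ⟨mem_orthogonalLogChart_of_mem_unitaryGroup (polarUnit_mem_unitaryGroup hg) ?_, ?_, ?_⟩
  · exact (mem_complexOrthogonalLogChart_carrier).1 (LogChart.polarUnit_mem hstar hgG hg le_rfl hρ')
  · exact (mem_complexOrthogonalLogChart_carrier).1 (LogChart.polarPos_mem hstar hgG hg le_rfl hρ')
  · exact (mem_complexOrthogonalLogChart_lie).1 (LogChart.I_smul_polarGen_mem_lie hstar hgG hg le_rfl hρ')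

/-- **`Gc = SO(N, ℂ)`: the unitary polar factor of `𝐔 ∈ SO(N, ℂ)`, `‖𝐔 − 1‖ ≤ ε ≤ 1/10`,
`3ε ≤ min(1/3, 3/N)`, lies in `SO(N)`**, and `U′ ∈ SO(N, ℂ)`. [folklore] -/
theorem polarUnit_mem_specialOrthogonal [Nonempty n] {g : Matrix n n ℂ} {ε : ℝ}
    (hgG : g ∈ (specialComplexOrthogonalLogChart n).carrier) (hg : ‖g - 1‖ ≤ ε) (hε : ε ≤ 1 / 10)
    (hρ : 3 * ε ≤ min (1 / 3) (3 / (Fintype.card n : ℝ))) :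
    polarUnit g ∈ (specialOrthogonalLogChart n).carrier ∧
      polarPos g ∈ (specialComplexOrthogonalLogChart n).carrier := by
  have hstar : ∀ ⦃g : Matrix n n ℂ⦄, g ∈ (specialComplexOrthogonalLogChart n).carrier →
      star g ∈ (specialComplexOrthogonalLogChart n).carrier := fun _ hg =>
    ⟨FederbushMean.star_mem_complexOrthogonalLogChart hg.1, FederbushMean.star_mem_specialLinearLogChart hg.2⟩
  have hρ' : 3 * ε ≤ (specialComplexOrthogonalLogChart n).ρ := by
    rw [specialComplexOrthogonalLogChart_ρ]
    exact le_min (by linarith [le_min_iff.1 hρ]) hρ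
  have hU := LogChart.polarUnit_mem hstar hgG hg hε hρ'
  refine ⟨?_, LogChart.polarPos_mem hstar hgG hg hε hρ'⟩
  have hUo := mem_orthogonalLogChart_of_mem_unitaryGroup (polarUnit_mem_unitaryGroup (hg.trans hε))
    ((mem_specialComplexOrthogonalLogChart_carrier).1 hU).1
  exact ⟨Matrix.mem_specialUnitaryGroup_iff.2 ⟨((mem_orthogonalLogChart_carrier).1 hUo).1,
    ((mem_specialComplexOrthogonalLogChart_carrier).1 hU).2⟩, ((mem_orthogonalLogChart_carrier).1 hUo).2⟩

/-! ## §4 The Cartan form `A′ ∈ 𝔤 = 𝔤c ∩ 𝔲(N)`, quantitative bounds, and uniqueness of the factors (v1.1) -/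

/-! ### §4a `A′` lies in the REAL Lie algebra -/

/-- `A′* = −A′`: the generator `A′ = −(i/2)P` is anti-Hermitian (`P* = P`). [folklore] -/
theorem star_polarGen {g : Matrix n n ℂ} (hg : ‖g - 1‖ ≤ 1 / 10) : star (polarGen g) = -polarGen g := by
  unfold polarGen
  rw [star_smul, star_polarLog hg, ← neg_smul]
  congr 1
  rw [star_neg, star_div₀, Complex.star_def, Complex.conj_I, map_ofNat, neg_div, neg_neg]

/-- `A′ ∈ 𝔲(N)` (the `U(N)` chart's Lie algebra `{A : A* = −A}`). [folklore] -/
theorem polarGen_mem_unitaryLogChart_lie {g : Matrix n n ℂ} (hg : ‖g - 1‖ ≤ 1 / 10) :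
    polarGen g ∈ (unitaryLogChart n).lie :=
  mem_unitaryLogChart_lie.2 (star_polarGen hg)

/-- `(A*)ᵀ = Ā` entrywise. [folklore] -/
theorem transpose_star_eq_conjEntry (A : Matrix n n ℂ) : (star A).transpose = conjEntry n A := by
  ext i j; simp [conjEntry_apply, Matrix.map_apply, Matrix.star_apply, Matrix.transpose_apply]

/-- A self-adjoint antisymmetric complex matrix is purely imaginary: `P* = P`, `Pᵀ = −P` ⟹ `P̄ = −P`. [folklore] -/
theorem conjEntry_eq_neg_of_star_eq_of_transpose_eq_neg {P : Matrix n n ℂ} (hs : star P = P)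
    (ht : P.transpose = -P) : conjEntry n P = -P := by
  rw [← transpose_star_eq_conjEntry, hs, ht]

namespace LogChart

variable {Gc : LogChart (Matrix n n ℂ)}

/-- **THE CARTAN FORM.**  If `𝔤c` is closed under multiplication by `i` (a complex Lie algebra, as print's `𝐠ᶜ`
is), then `A′ = −(i/2) log(𝐔𝐔*) ∈ 𝔤c` — and `A′ ∈ 𝔲(N)` by `polarGen_mem_unitaryLogChart_lie`, so `A′` lies in the
REAL form `𝔤c ∩ 𝔲(N)`. [folklore] -/
theorem polarGen_mem_lie (hstar : ∀ ⦃g⦄, g ∈ Gc.carrier → star g ∈ Gc.carrier)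
    (hI : ∀ ⦃X⦄, X ∈ Gc.lie → Complex.I • X ∈ Gc.lie) {g : Matrix n n ℂ} {ε : ℝ} (hgG : g ∈ Gc.carrier)
    (hg : ‖g - 1‖ ≤ ε) (hε : ε ≤ 1 / 10) (hρ : 3 * ε ≤ Gc.ρ) : polarGen g ∈ Gc.lie := by
  have h := hI (I_smul_polarGen_mem_lie hstar hgG hg hε hρ)
  rw [smul_smul, Complex.I_mul_I, neg_smul, one_smul] at h
  exact (Gc.lie.neg_mem_iff).1 h

/-- **PRINT'S FORM `𝐔 = U′U`, `U′ = exp iA′`, WITH `A′` IN THE REAL LIE ALGEBRA `𝔤c ∩ 𝔲(N)` AND `U ∈ Gc ∩ U(N)`**, for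
a `star`-closed log-charted `Gc` whose `𝔤c` is closed under `i`, at radius `ε ≤ min(1/10, ρ/3)`. [folklore] -/
theorem exists_cartan (hstar : ∀ ⦃g⦄, g ∈ Gc.carrier → star g ∈ Gc.carrier)
    (hI : ∀ ⦃X⦄, X ∈ Gc.lie → Complex.I • X ∈ Gc.lie) {g : Matrix n n ℂ} {ε : ℝ} (hgG : g ∈ Gc.carrier)
    (hg : ‖g - 1‖ ≤ ε) (hε : ε ≤ 1 / 10) (hρ : 3 * ε ≤ Gc.ρ) :
    ∃ A U : Matrix n n ℂ, A ∈ Gc.lie ∧ star A = -A ∧ U ∈ Gc.carrier ∧ U ∈ Matrix.unitaryGroup n ℂ ∧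
      g = exp (Complex.I • A) * U :=
  ⟨polarGen g, polarUnit g, polarGen_mem_lie hstar hI hgG hg hε hρ, star_polarGen (hg.trans hε),
    polarUnit_mem hstar hgG hg hε hρ, polarUnit_mem_unitaryGroup (hg.trans hε), by
      rw [← polarPos_eq_exp_I_smul_polarGen]; exact (polarPos_mul_polarUnit g).symm⟩

end LogChart

/-- `Gc = SL(N, ℂ)`: `A′ ∈ 𝔰𝔲(N)` (`A′* = −A′`, `tr A′ = 0`). [folklore] -/
theorem polarGen_mem_specialUnitaryLogChart_lie [Nonempty n] {g : Matrix n n ℂ} {ε : ℝ} (hdet : g.det = 1)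
    (hg : ‖g - 1‖ ≤ ε) (hε : ε ≤ 1 / 10) (hρ : 3 * ε ≤ min (1 / 3) (3 / (Fintype.card n : ℝ))) :
    polarGen g ∈ (specialUnitaryLogChart n).lie := by
  have hstar : ∀ ⦃g : Matrix n n ℂ⦄, g ∈ (specialLinearLogChart n).carrier →
      star g ∈ (specialLinearLogChart n).carrier := fun _ hg => FederbushMean.star_mem_specialLinearLogChart hg
  have hI : ∀ ⦃X : Matrix n n ℂ⦄, X ∈ (specialLinearLogChart n).lie →
      Complex.I • X ∈ (specialLinearLogChart n).lie := fun X hX => by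
    rw [mem_specialLinearLogChart_lie] at hX ⊢
    rw [Matrix.trace_smul, hX, smul_zero]
  have hgG : g ∈ (specialLinearLogChart n).carrier := (mem_specialLinearLogChart_carrier).2 hdet
  have hρ' : 3 * ε ≤ (specialLinearLogChart n).ρ := by rwa [specialLinearLogChart_ρ]
  exact mem_specialUnitaryLogChart_lie.2 ⟨star_polarGen (hg.trans hε),
    (mem_specialLinearLogChart_lie).1 (LogChart.polarGen_mem_lie hstar hI hgG hg hε hρ')⟩

/-- `Gc = O(N, ℂ)`: `A′ ∈ 𝔬(N)` (`A′* = −A′` and `A′` real, i.e. real antisymmetric). [folklore] -/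
theorem polarGen_mem_orthogonalLogChart_lie {g : Matrix n n ℂ} (ho : g.transpose * g = 1)
    (hg : ‖g - 1‖ ≤ 1 / 10) : polarGen g ∈ (orthogonalLogChart n).lie := by
  have hstar : ∀ ⦃g : Matrix n n ℂ⦄, g ∈ (complexOrthogonalLogChart n).carrier →
      star g ∈ (complexOrthogonalLogChart n).carrier :=
    fun _ hg => FederbushMean.star_mem_complexOrthogonalLogChart hg
  have hgG : g ∈ (complexOrthogonalLogChart n).carrier := (mem_complexOrthogonalLogChart_carrier).2 ho
  have hρ' : 3 * (1 / 10 : ℝ) ≤ (complexOrthogonalLogChart n).ρ := by rw [complexOrthogonalLogChart_ρ]; norm_num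
  have hP : (polarLog g).transpose = -polarLog g :=
    (mem_complexOrthogonalLogChart_lie).1 (LogChart.polarLog_mem_lie hstar hgG hg le_rfl hρ')
  have hPc : conjEntry n (polarLog g) = -polarLog g :=
    conjEntry_eq_neg_of_star_eq_of_transpose_eq_neg (star_polarLog hg) hP
  refine mem_orthogonalLogChart_lie.2 ⟨star_polarGen hg, ?_⟩
  unfold polarGen
  rw [conjEntry_smul, hPc, smul_neg, ← neg_smul]
  congr 1
  rw [map_neg, map_div₀, Complex.conj_I, map_ofNat, neg_div, neg_neg]

/-- `Gc = SO(N, ℂ)`: `A′ ∈ 𝔰𝔬(N)` (the `SO(N)` chart's Lie algebra `𝔰𝔲(N) ⊓ {real}`). [folklore] -/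
theorem polarGen_mem_specialOrthogonalLogChart_lie [Nonempty n] {g : Matrix n n ℂ} {ε : ℝ}
    (hgG : g ∈ (specialComplexOrthogonalLogChart n).carrier) (hg : ‖g - 1‖ ≤ ε) (hε : ε ≤ 1 / 10)
    (hρ : 3 * ε ≤ min (1 / 3) (3 / (Fintype.card n : ℝ))) :
    polarGen g ∈ (specialOrthogonalLogChart n).lie := by
  have h := (mem_specialComplexOrthogonalLogChart_carrier).1 hgG
  show polarGen g ∈ (specialUnitaryLogChart n).lie ⊓ (realLogChart n).lie
  rw [Submodule.mem_inf, realLogChart_lie, mem_realMatrix]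
  exact ⟨polarGen_mem_specialUnitaryLogChart_lie h.2 hg hε hρ,
    (mem_orthogonalLogChart_lie.1 (polarGen_mem_orthogonalLogChart_lie h.1 (hg.trans hε))).2⟩

/-! ### §4b Quantitative bounds `‖U′ − 1‖ ≤ (7/4)ε`, `‖U − 1‖ ≤ 3ε` -/

omit [Fintype n] [DecidableEq n] in
/-- `e^{x} − 1 ≤ (7/6)x` for `0 ≤ x ≤ 3/20` (Mathlib: `|e^{x} − 1 − x| ≤ x²` for `|x| ≤ 1`). [folklore] -/
theorem real_exp_sub_one_le {x : ℝ} (hx0 : 0 ≤ x) (hx : x ≤ 3 / 20) : Real.exp x - 1 ≤ 7 / 6 * x := by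
  have h1 : |x| ≤ 1 := by rw [abs_of_nonneg hx0]; linarith
  have h2 : Real.exp x - 1 - x ≤ x ^ 2 := (le_abs_self _).trans (Real.abs_exp_sub_one_sub_id_le h1)
  nlinarith

/-- `‖e^{±P/2} − 1‖ ≤ (7/4)ε` for `‖g − 1‖ ≤ ε ≤ 1/10` (`‖P/2‖ ≤ 3ε/2 ≤ 3/20`). [folklore] -/
theorem norm_exp_half_polarLog_sub_one_le {g : Matrix n n ℂ} {ε : ℝ} (hg : ‖g - 1‖ ≤ ε) (hε : ε ≤ 1 / 10)
    {X : Matrix n n ℂ} (hX : X = (1 / 2 : ℝ) • polarLog g ∨ X = -((1 / 2 : ℝ) • polarLog g)) :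
    ‖exp X - 1‖ ≤ 7 / 4 * ε := by
  have hε0 : 0 ≤ ε := (norm_nonneg _).trans hg
  have hP := norm_polarLog_le hg hε
  have hXn : ‖X‖ ≤ 3 / 2 * ε := by
    have h2 : ‖(1 / 2 : ℝ) • polarLog g‖ ≤ 3 / 2 * ε := by
      rw [norm_smul, Real.norm_of_nonneg (by norm_num : (0 : ℝ) ≤ 1 / 2)]; linarith
    rcases hX with rfl | rfl
    · exact h2
    · rw [norm_neg]; exact h2
  calc ‖exp X - 1‖ ≤ Real.exp ‖X‖ - 1 := norm_exp_sub_one_le_exp_norm_sub_one X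
    _ ≤ Real.exp (3 / 2 * ε) - 1 := by gcongr
    _ ≤ 7 / 6 * (3 / 2 * ε) := real_exp_sub_one_le (by positivity) (by linarith)
    _ = 7 / 4 * ε := by ring

/-- **`‖U′ − 1‖ ≤ (7/4)ε`.** [folklore] -/
theorem norm_polarPos_sub_one_le {g : Matrix n n ℂ} {ε : ℝ} (hg : ‖g - 1‖ ≤ ε) (hε : ε ≤ 1 / 10) :
    ‖polarPos g - 1‖ ≤ 7 / 4 * ε :=
  norm_exp_half_polarLog_sub_one_le hg hε (Or.inl rfl)

/-- **`‖U − 1‖ ≤ 3ε`** (`U − 1 = (e^{−P/2} − 1)(g − 1) + (e^{−P/2} − 1) + (g − 1)`). [folklore] -/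
theorem norm_polarUnit_sub_one_le {g : Matrix n n ℂ} {ε : ℝ} (hg : ‖g - 1‖ ≤ ε) (hε : ε ≤ 1 / 10) :
    ‖polarUnit g - 1‖ ≤ 3 * ε := by
  have hε0 : 0 ≤ ε := (norm_nonneg _).trans hg
  have hE := norm_exp_half_polarLog_sub_one_le hg hε (Or.inr rfl)
  set E := exp (-((1 / 2 : ℝ) • polarLog g)) with hEdef
  have h : polarUnit g - 1 = (E - 1) * (g - 1) + (E - 1) + (g - 1) := by
    show E * g - 1 = _; noncomm_ring
  rw [h]
  calc ‖(E - 1) * (g - 1) + (E - 1) + (g - 1)‖ ≤ ‖(E - 1) * (g - 1)‖ + ‖E - 1‖ + ‖g - 1‖ := norm_add₃_le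
    _ ≤ ‖E - 1‖ * ‖g - 1‖ + ‖E - 1‖ + ‖g - 1‖ := by gcongr; exact norm_mul_le _ _
    _ ≤ 7 / 4 * ε * ε + 7 / 4 * ε + ε := by gcongr
    _ ≤ 3 * ε := by nlinarith

/-! ### §4c Uniqueness of the local factors -/

/-- **UNIQUENESS OF THE POLAR FACTORS.**  If `g = e^{P′/2} U′` with `P′* = P′`, `‖P′‖ < ln 2` and `U′` unitary, then
`P′ = log(g g*)`, `e^{P′/2} = U′(g)`… precisely: `polarLog g = P′`, `polarPos g = e^{P′/2}`, `polarUnit g = U′`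
(`g g* = e^{P′/2} U′U′* e^{P′/2} = e^{P′}` and the tree's `B7BlockAvgLog.mlog_exp`). [folklore] -/
theorem polar_unique {g P' U' : Matrix n n ℂ} (hP : star P' = P') (hPn : ‖P'‖ < Real.log 2)
    (hU : U' ∈ Matrix.unitaryGroup n ℂ) (hgPU : g = exp ((1 / 2 : ℝ) • P') * U') :
    polarLog g = P' ∧ polarPos g = exp ((1 / 2 : ℝ) • P') ∧ polarUnit g = U' := by
  letI : NormedAlgebra ℚ (Matrix n n ℂ) := NormedAlgebra.restrictScalars ℚ ℂ _
  have hUU : U' * star U' = 1 := Matrix.mem_unitaryGroup_iff.1 hU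
  have hsE : star (exp ((1 / 2 : ℝ) • P')) = exp ((1 / 2 : ℝ) • P') := by
    rw [star_exp, star_smul, star_trivial, hP]
  have hhalf : (1 / 2 : ℝ) • P' + (1 / 2 : ℝ) • P' = P' := by rw [← add_smul]; norm_num
  have hgg : g * star g = exp P' := by
    calc g * star g = exp ((1 / 2 : ℝ) • P') * (U' * star U') * exp ((1 / 2 : ℝ) • P') := by
          rw [hgPU, star_mul, hsE]; noncomm_ring
      _ = exp P' := by
          rw [hUU, Matrix.mul_one, ← exp_add_of_commute (Commute.refl _), hhalf]
  have hlog : polarLog g = P' := by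
    unfold polarLog; rw [hgg]; exact B7BlockAvgLog.mlog_exp hPn
  refine ⟨hlog, by unfold polarPos; rw [hlog], ?_⟩
  unfold polarUnit
  rw [hlog, hgPU, ← Matrix.mul_assoc, ← exp_add_of_commute (Commute.refl _).neg_left, neg_add_cancel,
    exp_zero, Matrix.one_mul]

/-- **UNIQUENESS IN PRINT'S VARIABLES**: if `𝐔 = exp(iA) U` with `A* = −A`, `‖A‖ < (ln 2)/2`, `U` unitary, then
`A = A′(𝐔)` and `U = U(𝐔)`. [folklore] -/
theorem cartan_unique {g A U : Matrix n n ℂ} (hA : star A = -A) (hAn : ‖A‖ < Real.log 2 / 2)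
    (hU : U ∈ Matrix.unitaryGroup n ℂ) (hgAU : g = exp (Complex.I • A) * U) :
    polarGen g = A ∧ polarUnit g = U := by
  have hP : star ((2 : ℂ) • (Complex.I • A)) = (2 : ℂ) • (Complex.I • A) := by
    rw [star_smul, star_smul, hA, Complex.star_def, Complex.conj_I, map_ofNat, smul_neg, neg_smul, neg_neg]
  have hPn : ‖(2 : ℂ) • (Complex.I • A)‖ < Real.log 2 := by
    rw [norm_smul, norm_smul, Complex.norm_I, one_mul, Complex.norm_ofNat]; linarith
  have hhalf : (1 / 2 : ℝ) • ((2 : ℂ) • (Complex.I • A)) = Complex.I • A := by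
    rw [← Complex.coe_smul, smul_smul]; push_cast; norm_num
  have hg' : g = exp ((1 / 2 : ℝ) • ((2 : ℂ) • (Complex.I • A))) * U := by rw [hhalf]; exact hgAU
  have h := polar_unique hP hPn hU hg'
  refine ⟨?_, h.2.2⟩
  unfold polarGen
  rw [h.1, smul_smul, smul_smul, show -(Complex.I / 2) * 2 * Complex.I = -(Complex.I * Complex.I) by ring,
    Complex.I_mul_I, neg_neg, one_smul]

/-! ### §4d Positivity of `U′` -/

/-- `e^{X}` is a unit of `M_N(ℂ)` (inverse `e^{−X}`). [folklore] -/
theorem isUnit_exp_matrix (X : Matrix n n ℂ) : IsUnit (exp X) := by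
  letI : NormedAlgebra ℚ (Matrix n n ℂ) := NormedAlgebra.restrictScalars ℚ ℂ _
  have h1 : exp X * exp (-X) = 1 := by
    rw [← exp_add_of_commute (Commute.refl X).neg_right, add_neg_cancel, exp_zero]
  have h2 : exp (-X) * exp X = 1 := by
    rw [← exp_add_of_commute (Commute.refl X).neg_left, neg_add_cancel, exp_zero]
  exact ⟨⟨exp X, exp (-X), h1, h2⟩, rfl⟩

/-- `U′ = (e^{P/4})ᴴ e^{P/4}`. [folklore] -/
theorem polarPos_eq_conjTranspose_mul_self {g : Matrix n n ℂ} (hg : ‖g - 1‖ ≤ 1 / 10) :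
    polarPos g = (exp ((1 / 4 : ℝ) • polarLog g)).conjTranspose * exp ((1 / 4 : ℝ) • polarLog g) := by
  letI : NormedAlgebra ℚ (Matrix n n ℂ) := NormedAlgebra.restrictScalars ℚ ℂ _
  have hC : star (exp ((1 / 4 : ℝ) • polarLog g)) = exp ((1 / 4 : ℝ) • polarLog g) := by
    rw [star_exp, star_smul, star_trivial, star_polarLog hg]
  have h4 : (1 / 4 : ℝ) • polarLog g + (1 / 4 : ℝ) • polarLog g = (1 / 2 : ℝ) • polarLog g := by
    rw [← add_smul]; norm_num
  rw [← Matrix.star_eq_conjTranspose, hC, ← exp_add_of_commute (Commute.refl _), h4]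
  rfl

/-- **`U′` IS POSITIVE DEFINITE** (`U′ = CᴴC` with `C = e^{P/4}` invertible; Mathlib `Matrix.PosDef.conjTranspose_mul_self`).
This is the «positivity of `U′`» the v1 header listed as not encoded. [folklore] -/
theorem posDef_polarPos {g : Matrix n n ℂ} (hg : ‖g - 1‖ ≤ 1 / 10) : (polarPos g).PosDef := by
  rw [polarPos_eq_conjTranspose_mul_self hg]
  exact Matrix.PosDef.conjTranspose_mul_self _ (Matrix.mulVec_injective_of_isUnit (isUnit_exp_matrix _))

/-- `U′` is Hermitian with positive eigenvalues. [folklore] -/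
theorem polarPos_eigenvalues_pos {g : Matrix n n ℂ} (hg : ‖g - 1‖ ≤ 1 / 10) (i : n) :
    0 < (posDef_polarPos hg).1.eigenvalues i :=
  (posDef_polarPos hg).eigenvalues_pos i

/-- `𝐔𝐔*` is positive definite for `‖𝐔 − 1‖ < 1` (`𝐔 = e^{log 𝐔}` is a unit; Mathlib
`Matrix.PosDef.mul_conjTranspose_self`). [folklore] -/
theorem posDef_self_mul_star {g : Matrix n n ℂ} (hg : ‖g - 1‖ < 1) : (g * star g).PosDef := by
  have hu : IsUnit g := by rw [← exp_mlog hg]; exact isUnit_exp_matrix _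
  rw [Matrix.star_eq_conjTranspose]
  exact Matrix.PosDef.mul_conjTranspose_self _ (Matrix.vecMul_injective_of_isUnit hu)

/-! ### Non-vacuity -/

/-- At `𝐔 = 1`: `P = 0`, `U′ = U = 1`. [folklore] -/
example : polarUnit (1 : Matrix n n ℂ) ∈ Matrix.unitaryGroup n ℂ :=
  polarUnit_mem_unitaryGroup (by simp)

end Literature.MathematicalPhysics.QuantumFieldTheory.Balaban1983to89
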